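import Summits.Parity.BatemanHorn.Theorems.SoloInformedPowerValuesRpow
import Summits.Parity.BatemanHorn.Theorems.SoloInformedQuadraticPrimeCount

/-!
# Proper prime powers among the values of an irreducible polynomial are `O(x^{1-η})`

SOLOIST deliverable (unit `solo-Parity-informed`, session 16).  For `g ∈ ℤ[X]` irreducible of degree
`d ≥ 1` with positive leading coefficient:

  `#{1 ≤ n ≤ x : |g(n)| = p^a, p prime, a ≥ 2} · log^j x ≤ δ x`   eventually, every `j`, `δ > 0`

(`eventually_card_properPrimePow_mul_log_pow_le`).  Census by exponent: `2 ≤ a ≤ d` is an `a`-th power value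
(`SoloInformedPowerValuesRpow`, a power saving), and `a ≥ d + 1` forces `p ≤ (e^B x^d)^{1/(d+1)}`,
`a ≤ log(e^B x^d)/log 2` with each value taken `≤ 2d` times, `O(x^{1 - 1/(2(d+1))})` in all
(`filter_properPrimePow_subset`, `exists_eventually_higherPow_count_le_rpow`).  This is the input that makes the
degenerate arguments of a Bateman–Horn `k`-tuple negligible against `log^k` weights.
-/

namespace Summit.Parity.BatemanHorn.Theorems

open Finset Filter Polynomial Asymptotics
open scoped Topology

open scoped Classical in
/-- **Census of proper prime power values by exponent.**  With `|log |g(n)| - d log n| ≤ B` (`n ≥ 1`):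
a value `|g(n)| = p^a` (`1 ≤ n ≤ x`, `p` prime, `a ≥ 2`) is an `a`-th power value with `a ≤ d`, or has
`p ≤ (e^B x^d)^{1/(d+1)}` and `a ≤ log(e^B x^d)/log 2`. -/
theorem filter_properPrimePow_subset (g : ℤ[X]) {d : ℕ} (hdeg : g.natDegree = d) {B : ℝ}
    (hB : ∀ n : ℕ, 1 ≤ n → |Real.log ((g.eval (n : ℤ)).natAbs : ℝ) - g.natDegree * Real.log n| ≤ B)
    (x : ℕ) :
    ((Icc 1 x).filter fun n : ℕ => ∃ p a : ℕ, p.Prime ∧ 2 ≤ a ∧ (g.eval (n : ℤ)).natAbs = p ^ a)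
      ⊆ ((Icc 2 d).biUnion fun a : ℕ =>
            (Icc 1 x).filter fun n : ℕ => ∃ m : ℕ, (g.eval (n : ℤ)).natAbs = m ^ a)
        ∪ (range (⌊(Real.exp B * (x : ℝ) ^ d) ^ ((d + 1 : ℕ) : ℝ)⁻¹⌋₊ + 1)).biUnion fun m : ℕ =>
            (range (⌊Real.log (Real.exp B * (x : ℝ) ^ d) / Real.log 2⌋₊ + 1)).biUnion fun a : ℕ =>
              (Icc 1 x).filter fun n : ℕ => (g.eval (n : ℤ)).natAbs = m ^ a := by
  set Y : ℝ := Real.exp B * (x : ℝ) ^ d with hY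
  have hd0 : (0 : ℝ) ≤ d := Nat.cast_nonneg _
  have hlog2 : 0 < Real.log 2 := Real.log_pos (by norm_num)
  intro n hn
  obtain ⟨hnI, p, a, hp, ha, hpa⟩ := mem_filter.mp hn
  obtain ⟨hn1, hnx⟩ := mem_Icc.mp hnI
  rw [mem_union]
  by_cases had : a ≤ d
  · exact Or.inl (mem_biUnion.mpr ⟨a, mem_Icc.mpr ⟨ha, had⟩, mem_filter.mpr ⟨hnI, p, hpa⟩⟩)
  right
  have hk4 : d + 1 ≤ a := by omega
  have hgY : (((g.eval (n : ℤ)).natAbs : ℕ) : ℝ) ≤ Y := by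
    have h1 := (abs_le.mp (hB n hn1)).2
    rw [hdeg] at h1
    have h2 : Real.log n ≤ Real.log x :=
      Real.log_le_log (by exact_mod_cast hn1) (by exact_mod_cast hnx)
    have h3 := mul_le_mul_of_nonneg_left h2 hd0
    have hg0 : (0 : ℝ) < ((g.eval (n : ℤ)).natAbs : ℕ) := by
      rw [hpa]
      exact_mod_cast pow_pos hp.pos a
    have hx0 : (0 : ℝ) < x := by exact_mod_cast (show 0 < x by omega)
    rw [← Real.exp_log hg0, hY, show Real.exp B * (x : ℝ) ^ d = Real.exp (Real.log ((x : ℝ) ^ d) + B) by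
      rw [Real.exp_add, Real.exp_log (by positivity), mul_comm]]
    refine Real.exp_le_exp.mpr ?_
    rw [Real.log_pow]
    linarith
  have hpkR : ((p : ℝ) ^ a) = (((g.eval (n : ℤ)).natAbs : ℕ) : ℝ) := by exact_mod_cast hpa.symm
  have hpP : p ∈ range (⌊Y ^ ((d + 1 : ℕ) : ℝ)⁻¹⌋₊ + 1) := by
    rw [mem_range, Nat.lt_add_one_iff]
    refine Nat.le_floor ?_
    have h4 : (p : ℝ) ^ (d + 1) ≤ Y := by
      calc (p : ℝ) ^ (d + 1) ≤ (p : ℝ) ^ a := pow_le_pow_right₀ (by exact_mod_cast hp.one_lt.le) hk4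
        _ ≤ Y := hpkR ▸ hgY
    have hroot : ((p : ℝ) ^ (d + 1)) ^ ((d + 1 : ℕ) : ℝ)⁻¹ = p :=
      Real.pow_rpow_inv_natCast (Nat.cast_nonneg p) (by omega)
    calc (p : ℝ) = ((p : ℝ) ^ (d + 1)) ^ ((d + 1 : ℕ) : ℝ)⁻¹ := hroot.symm
      _ ≤ Y ^ ((d + 1 : ℕ) : ℝ)⁻¹ := Real.rpow_le_rpow (by positivity) h4 (by positivity)
  have hkK : a ∈ range (⌊Real.log Y / Real.log 2⌋₊ + 1) := by
    rw [mem_range, Nat.lt_add_one_iff]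
    refine Nat.le_floor ?_
    rw [le_div_iff₀ hlog2]
    have h2k : (2 : ℝ) ^ a ≤ Y := by
      calc (2 : ℝ) ^ a ≤ (p : ℝ) ^ a := pow_le_pow_left₀ (by norm_num) (by exact_mod_cast hp.two_le) a
        _ ≤ Y := hpkR ▸ hgY
    have := Real.log_le_log (by positivity) h2k
    rwa [Real.log_pow] at this
  exact mem_biUnion.mpr ⟨p, hpP, mem_biUnion.mpr ⟨a, hkK, mem_filter.mpr ⟨hnI, hpa⟩⟩⟩

/-- **The higher-power census is `O(x^{1 - 1/(2(d+1))})`:** for `d ≥ 1`, `B ≥ 0` there is `C` with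
`(P_x + 1)(K_x + 1) · 2d ≤ C x^{1 - 1/(2(d+1))}` eventually, `P_x = ⌊(e^B x^d)^{1/(d+1)}⌋`,
`K_x = ⌊log(e^B x^d)/log 2⌋`. -/
theorem exists_eventually_higherPow_count_le_rpow {d : ℕ} (hd : 0 < d) {B : ℝ} (hB0 : 0 ≤ B) :
    ∃ C : ℝ, ∀ᶠ x : ℕ in atTop,
      (((⌊(Real.exp B * (x : ℝ) ^ d) ^ ((d + 1 : ℕ) : ℝ)⁻¹⌋₊ + 1)
        * (⌊Real.log (Real.exp B * (x : ℝ) ^ d) / Real.log 2⌋₊ + 1) * (2 * d) : ℕ) : ℝ)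
        ≤ C * (x : ℝ) ^ (1 - ((d + 1 : ℕ) : ℝ)⁻¹ / 2) := by
  have hd0 : (0 : ℝ) < d := by exact_mod_cast hd
  have hd1 : (0 : ℝ) < ((d + 1 : ℕ) : ℝ) := by positivity
  set s : ℝ := ((d + 1 : ℕ) : ℝ)⁻¹ with hs
  have hs0 : 0 < s := inv_pos.mpr hd1
  have hds : (d : ℝ) * s + s = 1 := by
    rw [hs]
    field_simp
    push_cast
    ring
  set c₀ : ℝ := Real.exp (B * s) with hc₀
  have hc₀0 : 0 < c₀ := Real.exp_pos _
  have hc₀1 : 1 ≤ c₀ := by rw [hc₀]; exact Real.one_le_exp (by positivity)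
  have hlog2 : 0 < Real.log 2 := Real.log_pos (by norm_num)
  have hlog2' : Real.log 2 < 1 := by
    have := Real.log_two_lt_d9; norm_num at this; linarith
  have hlog2ne : Real.log 2 ≠ 0 := hlog2.ne'
  have hlog : Tendsto (fun x : ℕ => Real.log x) atTop atTop :=
    Real.tendsto_log_atTop.comp tendsto_natCast_atTop_atTop
  refine ⟨2 * c₀ * (((d : ℝ) + 2) / Real.log 2) * (2 * d), ?_⟩
  filter_upwards [eventually_log_pow_le_mul_rpow 1 (show 0 < s / 2 by positivity) one_pos,
    hlog.eventually (eventually_ge_atTop (max B 1)), eventually_ge_atTop 1] with x hx hL hx1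
  rw [pow_one, one_mul] at hx
  set L := Real.log x with hL'
  have hBL : B ≤ L := le_trans (le_max_left _ _) hL
  have hL1 : 1 ≤ L := le_trans (le_max_right _ _) hL
  have hL0 : 0 ≤ L := by linarith
  have hx0 : (0 : ℝ) < x := by exact_mod_cast hx1
  -- `Y^{1/(d+1)} = c₀ x^{d/(d+1)}`, `log Y = B + d L`
  have hYs : (Real.exp B * (x : ℝ) ^ d) ^ s = c₀ * (x : ℝ) ^ ((d : ℝ) * s) := by
    rw [Real.mul_rpow (Real.exp_pos _).le (by positivity), hc₀, ← Real.exp_mul,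
      show ((x : ℝ) ^ d) = (x : ℝ) ^ (d : ℝ) by exact_mod_cast (Real.rpow_natCast (x : ℝ) d).symm,
      ← Real.rpow_mul hx0.le]
  have hlogY : Real.log (Real.exp B * (x : ℝ) ^ d) = B + d * L := by
    rw [Real.log_mul (Real.exp_pos _).ne' (by positivity), Real.log_exp, Real.log_pow]
  have hxds : 1 ≤ c₀ * (x : ℝ) ^ ((d : ℝ) * s) := by
    have h2 : (1 : ℝ) ≤ (x : ℝ) ^ ((d : ℝ) * s) := Real.one_le_rpow (by exact_mod_cast hx1) (by positivity)
    nlinarith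
  -- the two factors
  have hP : ((⌊(Real.exp B * (x : ℝ) ^ d) ^ s⌋₊ : ℕ) : ℝ) + 1 ≤ 2 * (c₀ * (x : ℝ) ^ ((d : ℝ) * s)) := by
    have hfl := Nat.floor_le (show 0 ≤ (Real.exp B * (x : ℝ) ^ d) ^ s by positivity)
    linarith [hYs]
  have hK : ((⌊Real.log (Real.exp B * (x : ℝ) ^ d) / Real.log 2⌋₊ : ℕ) : ℝ) + 1
      ≤ ((d : ℝ) + 2) * L / Real.log 2 := by
    have hfl := Nat.floor_le (show 0 ≤ Real.log (Real.exp B * (x : ℝ) ^ d) / Real.log 2 by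
      rw [hlogY]; positivity)
    have e : Real.log (Real.exp B * (x : ℝ) ^ d) / Real.log 2 + 1 ≤ ((d : ℝ) + 2) * L / Real.log 2 := by
      rw [hlogY, div_add_one hlog2ne, div_le_div_iff_of_pos_right hlog2]
      linarith
    linarith
  have hK' : ((⌊Real.log (Real.exp B * (x : ℝ) ^ d) / Real.log 2⌋₊ : ℕ) : ℝ) + 1
      ≤ ((d : ℝ) + 2) / Real.log 2 * (x : ℝ) ^ (s / 2) := by
    refine hK.trans ?_
    rw [mul_div_assoc, div_mul_eq_mul_div, mul_div_assoc]
    exact mul_le_mul_of_nonneg_left (div_le_div_of_nonneg_right hx hlog2.le) (by positivity)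
  -- assemble
  have hx' : (x : ℝ) ^ ((d : ℝ) * s) * (x : ℝ) ^ (s / 2) = (x : ℝ) ^ (1 - s / 2) := by
    rw [← Real.rpow_add hx0]
    congr 1
    linarith
  calc (((⌊(Real.exp B * (x : ℝ) ^ d) ^ s⌋₊ + 1)
        * (⌊Real.log (Real.exp B * (x : ℝ) ^ d) / Real.log 2⌋₊ + 1) * (2 * d) : ℕ) : ℝ)
      = ((((⌊(Real.exp B * (x : ℝ) ^ d) ^ s⌋₊ : ℕ) : ℝ) + 1)
        * (((⌊Real.log (Real.exp B * (x : ℝ) ^ d) / Real.log 2⌋₊ : ℕ) : ℝ) + 1) * (2 * d)) := by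
        push_cast
        ring
    _ ≤ (2 * (c₀ * (x : ℝ) ^ ((d : ℝ) * s))) * (((d : ℝ) + 2) / Real.log 2 * (x : ℝ) ^ (s / 2))
        * (2 * d) := by gcongr
    _ = 2 * c₀ * (((d : ℝ) + 2) / Real.log 2) * (2 * d) * ((x : ℝ) ^ ((d : ℝ) * s) * (x : ℝ) ^ (s / 2)) := by
        ring
    _ = 2 * c₀ * (((d : ℝ) + 2) / Real.log 2) * (2 * d) * (x : ℝ) ^ (1 - s / 2) := by rw [hx']

open scoped Classical in
/-- **Proper prime powers among polynomial values are negligible against every power of `log`.**  For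
`g ∈ ℤ[X]` irreducible of degree `≥ 1` with positive leading coefficient, every `j` and `δ > 0`:
`#{1 ≤ n ≤ x : |g(n)| = p^a, p prime, a ≥ 2} · log^j x ≤ δ x` eventually. -/
theorem eventually_card_properPrimePow_mul_log_pow_le {g : ℤ[X]} (hirr : Irreducible g)
    (hdeg : 1 ≤ g.natDegree) (hlc : 0 < g.leadingCoeff) (j : ℕ) {δ : ℝ} (hδ : 0 < δ) :
    ∀ᶠ x : ℕ in atTop,
      (#((Icc 1 x).filter fun n : ℕ => ∃ p a : ℕ, p.Prime ∧ 2 ≤ a ∧ (g.eval (n : ℤ)).natAbs = p ^ a) : ℝ)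
        * Real.log x ^ j ≤ δ * x := by
  have hdeg0 : 0 < g.natDegree := hdeg
  obtain ⟨B, hB⟩ := exists_abs_log_natAbs_eval_sub_le hdeg0
  have hB0 : 0 ≤ B := (abs_nonneg _).trans (hB 1 le_rfl)
  set d := g.natDegree with hd
  have hd0R : (0 : ℝ) < d := by exact_mod_cast hdeg0
  -- every exponent `2 ≤ a ≤ d` contributes `≤ δ' x`, `δ' = δ / (2 d)`
  set δ' : ℝ := δ / (2 * d) with hδ'
  have hδ'0 : 0 < δ' := by positivity
  have h_each : ∀ a ∈ Icc 2 d, ∀ᶠ x : ℕ in atTop,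
      (#((Icc 1 x).filter fun n : ℕ => ∃ m : ℕ, (g.eval (n : ℤ)).natAbs = m ^ a) : ℝ)
        * Real.log x ^ j ≤ δ' * x :=
    fun a ha => eventually_card_powValues_mul_log_pow_le hirr hdeg hlc (mem_Icc.mp ha).1 j hδ'0
  have h1 := (Filter.eventually_all_finset (Icc 2 d)).mpr h_each
  -- the higher powers contribute `≤ δ/2 · x`
  obtain ⟨C, hC⟩ := exists_eventually_higherPow_count_le_rpow hdeg0 hB0
  have hη : (0 : ℝ) < ((d + 1 : ℕ) : ℝ)⁻¹ / 2 := by positivity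
  have h2 := eventually_mul_log_pow_le_of_le_rpow hη hC j (show 0 < δ / 2 by positivity)
  filter_upwards [h1, h2, eventually_ge_atTop 1] with x hx1 hx2 hx
  have hL0 : 0 ≤ Real.log x ^ j := pow_nonneg (Real.log_nonneg (by exact_mod_cast hx)) j
  have hincl := filter_properPrimePow_subset g hd.symm hB x
  have hhi := card_biUnion_natAbs_eval_eq_pow_le g hdeg0 (Icc 1 x)
    ⌊(Real.exp B * (x : ℝ) ^ d) ^ ((d + 1 : ℕ) : ℝ)⁻¹⌋₊ ⌊Real.log (Real.exp B * (x : ℝ) ^ d) / Real.log 2⌋₊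
  rw [← hd] at hhi
  have hcard : (#((Icc 1 x).filter fun n : ℕ =>
      ∃ p a : ℕ, p.Prime ∧ 2 ≤ a ∧ (g.eval (n : ℤ)).natAbs = p ^ a) : ℝ)
      ≤ (∑ a ∈ Icc 2 d, (#((Icc 1 x).filter fun n : ℕ => ∃ m : ℕ, (g.eval (n : ℤ)).natAbs = m ^ a) : ℝ))
        + (((⌊(Real.exp B * (x : ℝ) ^ d) ^ ((d + 1 : ℕ) : ℝ)⁻¹⌋₊ + 1)
            * (⌊Real.log (Real.exp B * (x : ℝ) ^ d) / Real.log 2⌋₊ + 1) * (2 * d) : ℕ) : ℝ) := by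
    have h := (card_le_card hincl).trans ((card_union_le _ _).trans
      (add_le_add card_biUnion_le hhi))
    exact_mod_cast h
  have hmid : (∑ a ∈ Icc 2 d,
      (#((Icc 1 x).filter fun n : ℕ => ∃ m : ℕ, (g.eval (n : ℤ)).natAbs = m ^ a) : ℝ)) * Real.log x ^ j
        ≤ d * (δ' * x) := by
    rw [Finset.sum_mul]
    refine (sum_le_sum fun a ha => hx1 a ha).trans ?_
    rw [sum_const, nsmul_eq_mul, Nat.card_Icc]
    have hc : ((d + 1 - 2 : ℕ) : ℝ) ≤ d := by exact_mod_cast (by omega : d + 1 - 2 ≤ d)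
    exact mul_le_mul_of_nonneg_right hc (by positivity)
  have hmid' : (d : ℝ) * (δ' * x) = δ / 2 * x := by
    rw [hδ']
    field_simp
  calc (#((Icc 1 x).filter fun n : ℕ =>
        ∃ p a : ℕ, p.Prime ∧ 2 ≤ a ∧ (g.eval (n : ℤ)).natAbs = p ^ a) : ℝ) * Real.log x ^ j
      ≤ ((∑ a ∈ Icc 2 d, (#((Icc 1 x).filter fun n : ℕ => ∃ m : ℕ, (g.eval (n : ℤ)).natAbs = m ^ a) : ℝ))
        + (((⌊(Real.exp B * (x : ℝ) ^ d) ^ ((d + 1 : ℕ) : ℝ)⁻¹⌋₊ + 1)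
            * (⌊Real.log (Real.exp B * (x : ℝ) ^ d) / Real.log 2⌋₊ + 1) * (2 * d) : ℕ) : ℝ))
          * Real.log x ^ j := mul_le_mul_of_nonneg_right hcard hL0
    _ = (∑ a ∈ Icc 2 d, (#((Icc 1 x).filter fun n : ℕ => ∃ m : ℕ, (g.eval (n : ℤ)).natAbs = m ^ a) : ℝ))
          * Real.log x ^ j
        + (((⌊(Real.exp B * (x : ℝ) ^ d) ^ ((d + 1 : ℕ) : ℝ)⁻¹⌋₊ + 1)
            * (⌊Real.log (Real.exp B * (x : ℝ) ^ d) / Real.log 2⌋₊ + 1) * (2 * d) : ℕ) : ℝ)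
          * Real.log x ^ j := by ring
    _ ≤ d * (δ' * x) + δ / 2 * x := add_le_add hmid hx2
    _ = δ * x := by rw [hmid']; ring

end Summit.Parity.BatemanHorn.Theorems
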